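import Summits.QuantumFields.YangMills.Theorems.BalabanUVNodesN15TwoGridEntry2Rough
import Summits.QuantumFields.YangMills.Theorems.BalabanUVNodesN15TwoGridBoxAvg
import HarnessLib

/-!
# N15 (NE2) — Bałaban's full propagator pair, part 71: ★★★ ENTRY 2 OF [B9] (3.42), `𝔇(G∇*)`, IN SUP-BLOCK CURRENCY, HYPOTHESIS-FREE

WHO / WHEN.  Cell `pub-ymgap`, seat `pub-ymgap-dag-n15-a` (KNIT-BY-NAME, g13); `--supports stmt-QuantumFields-20507 --as helper` (count-neutral); `HOME/pub-ymgap-dag-n15-a/DOOR-IV-PLAN.md` §7.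
Over parts 69 (`hasMajL2_twoGridDefect_div`: entry 2 in L²-block output currency), 70 (`hasMaj_sup_of_l2Blocks_osc`: sub-box interpolation), 66 (`hasMaj_divSteps_of_ineq`: multi-step tensor
(1.111)), 58 (`shiftSub_X_pull_split`, `hasMaj_comp_pull_kingPrV`, `four_mul_div_le`), 44 (`hasMaj_shiftPull_sub`), 43 (`hasMaj_pull_comp₂`), 42 ((1.110), `ineq110_114_pair`).
WHAT.  (§113) ★ `hasMaj_osc_entry2`: on one torus, for a sub-box side `ℓ` with `4ℓ ≤ n′`, `L^m ≤ ℓ`: every `t < ℓ`-step oscillation `(ρ′(s_i^t) − 1)∘T2_μ` of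
`T2_μ = idef P P (G′∇′_μ*) (G∇_μ*)` has the sup majorant `C₁(2 + e^{δ₀})·(ℓ∕n′)^α·e^{−δ₀d}` — fine oscillation of `G′∇′*` through `P` on the source, and for `PG∇*` the split
`t = qL^m + i` of part 58 (in-block part `(ρ′(s^i)P − P)G∇*` = one coarse step, `q` coarse steps prolonged).  `hasMaj_entry2_apriori` (no rate, (1.110) both members).
(§114) rate bookkeeping `sqrt_pow_mul_rpow_le`, `pow_rpow_neg_half_le`; ★★★ **`hasMaj_twoGridDefect_div`**: for odd `L ≥ 3`, `a > 0`: `∃ δ C > 0 ∀ m_T, k ≥ 1, m, μ`,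
`HasMaj (ofBlocks blkFine) (ofBlocks blockOf′) (idef P P (G′∘ρ′(n′(s_μ⁻¹−1))) (G∘ρ(n(s_μ⁻¹−1)))) (C·(L^k)^{−1∕(8(d+1))}·e^{−δ|y−y′|_T})` — ENTRY 2 for Bałaban's full Landau-gauge
pair at `U ≡ 1`, the honest `T2` of part 60's readout: part 69's L²-block majorant `(L^k)^{−1∕4}` interpolated on sub-boxes of physical side `L^{−⌊k∕4(d+1)⌋}` (amplification
`L^{⌊k∕4(d+1)⌋(d+1)∕2} ≤ (L^k)^{1∕8}`) against the `(ℓ∕n′)^{1∕2}`-oscillation; `k < 8(d+1)` by the a-priori bound.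
HONEST FRAMING ∕ LIMITS.  `U ≡ 1` torus family; the rate `1∕(8(d+1))` is what this sup-only-readable currency affords (Bałaban's (3.42) states `O(1)` smallness in weighted norms for
general `U`); count-neutral (typed 28∕28 · discharged 5∕27 of record unchanged); NOT a discharge of N15 (`NE2PlusOperator`, object-bound); not ℝ⁴ ∕ OS ∕ mass gap ∕ Clay.
-/

open scoped BigOperators
open Finset

namespace Summit.QuantumFields.YangMills.BalabanUVNodes.N15.TwoGrid

open Literature.MathematicalPhysics.QuantumFieldTheory.Balaban1983to89
open Literature.MathematicalPhysics.QuantumFieldTheory.Balaban1983to89.B11SectG (BlockNorm HasMaj)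
open Literature.MathematicalPhysics.QuantumFieldTheory.Balaban1983to89.T4EtaRateDefect (idef)
open Literature.MathematicalPhysics.QuantumFieldTheory.Balaban1983to89.T4EtaRateCoeffDefect (pull)
open Literature.MathematicalPhysics.QuantumFieldTheory.Balaban1983to89.B5Prop11Plancherel (Tor fine)
open Literature.MathematicalPhysics.QuantumFieldTheory.Balaban1983to89.B5SettingP12Real (latticeSettingP12R)
open Literature.MathematicalPhysics.QuantumFieldTheory.Balaban1983to89.B5SettingP12Weighted (etaPow etaPow_nonneg)
open Literature.MathematicalPhysics.QuantumFieldTheory.Balaban1983to89.B5SiteBridgeP12 (MP)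
open Literature.MathematicalPhysics.QuantumFieldTheory.Balaban1983to89.B5CoverP12Lattice (Lθ Lθ_nonneg)
open Literature.MathematicalPhysics.QuantumFieldTheory.King1986.Torus (blockOf tdistT tdistT_nonneg)
open Literature.MathematicalPhysics.QuantumFieldTheory.Balaban1983to89.B6UnitTorusCarrier (unitTorusGeo)
open Summit.QuantumFields.YangMills.BalabanUVNodes.N15.VectorPiece (blkFine kingPrV blkFine_comp_kingPrV)

variable {d : ℕ}

/-! ## §113 ★ The multi-step oscillations of `T2 = 𝔇(G∇_μ*)` -/

section Osc

variable {L : ℕ} [NeZero L] (M : Fin (d + 1) → ℕ) [∀ μ, NeZero (M μ)] (k m : ℕ) (a : ℝ)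

/-- ★ **`t`-STEP OSCILLATIONS OF `T2 = G′∇′_μ*P − PG∇_μ*`**, `t < ℓ`, `4ℓ ≤ n′`, `L^m ≤ ℓ`, `M_μ ≥ 2`: sup majorant `|C_α|(Lθ+1)e^{δ₀}·(2 + e^{δ₀})·(ℓ∕n′)^α·e^{−δ₀d}` from the coarse and fine
(1.110)–(1.111) packages. [cite: Balaban1984PropagatorsI, Prop. 1.2 (1.111) p.35; King1986, p.664 (pairing convention)] -/
theorem hasMaj_osc_entry2 (hM2 : ∀ μ, 2 ≤ M μ) {K K' : ℕ} {C₀ δ₀ : ℝ} {Cα Cε : ℝ → ℝ} {Cαε : ℝ → ℝ → ℝ} (hδ₀ : 0 ≤ δ₀)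
    (HP : B5.Ineq110_114 (latticeSettingP12R (L ^ k) M a K) C₀ Cα Cε Cαε δ₀)
    (HP' : B5.Ineq110_114 (latticeSettingP12R (L ^ m * L ^ k) M a K') C₀ Cα Cε Cαε δ₀) {α : ℝ} (hα0 : 0 ≤ α) (hα1 : α < 1)
    {ℓ : ℕ} (h4ℓ : 4 * ℓ ≤ L ^ m * L ^ k) (hmℓ : L ^ m ≤ ℓ) (μ i : Fin (d + 1)) {t : ℕ} (ht : t < ℓ) :
    HasMaj (BlockNorm.ofBlocks (unitTorusGeo L k M) (blkFine L k M))
      (BlockNorm.ofBlocks (unitTorusGeo L k M) (fun z : Tor (fine (L ^ m * L ^ k) M) × Fin (d + 1) => blockOf (L ^ m * L ^ k) M z.1))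
      (symbOp M (L ^ m * L ^ k) (sT M (L ^ m * L ^ k) i ^ t - 1) ∘ₗ
        idef (pull (kingPrV L k m M)) (pull (kingPrV L k m M))
          (gOp M (L ^ m * L ^ k) a ∘ₗ symbOp M (L ^ m * L ^ k) (((L ^ m * L ^ k : ℕ) : ℝ) • (sTinv M (L ^ m * L ^ k) μ - 1)))
          (gOp M (L ^ k) a ∘ₗ symbOp M (L ^ k) (((L ^ k : ℕ) : ℝ) • (sTinv M (L ^ k) μ - 1))))
      (fun y y' => |Cα α| * (Lθ (d + 1) + 1) * Real.exp δ₀ * (2 + Real.exp δ₀) * ((ℓ : ℝ) / ((L ^ m * L ^ k : ℕ) : ℝ)) ^ α * Real.exp (-(δ₀ * tdistT M y y'))) := by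
  classical
  haveI : NeZero (L ^ k) := ⟨pow_ne_zero k (NeZero.ne L)⟩
  haveI : NeZero (L ^ m * L ^ k) := ⟨Nat.mul_ne_zero (pow_ne_zero m (NeZero.ne L)) (pow_ne_zero k (NeZero.ne L))⟩
  have hL0 : 0 < L := Nat.pos_of_ne_zero (NeZero.ne L)
  have hR0 : L ^ m ≠ 0 := pow_ne_zero m (NeZero.ne L)
  have hR1 : 1 ≤ L ^ m := Nat.one_le_pow _ _ hL0
  have hn1 : 1 ≤ L ^ k := Nat.one_le_pow _ _ hL0
  have hn0 : (0 : ℝ) < ((L ^ k : ℕ) : ℝ) := by exact_mod_cast hn1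
  have hn'0 : (0 : ℝ) < ((L ^ m * L ^ k : ℕ) : ℝ) := by exact_mod_cast (NeZero.ne (L ^ m * L ^ k) |> Nat.pos_of_ne_zero)
  obtain ⟨C₁, hC₁⟩ : ∃ C₁ : ℝ, C₁ = |Cα α| * (Lθ (d + 1) + 1) * Real.exp δ₀ := ⟨_, rfl⟩
  have hC₁0 : 0 ≤ C₁ := by rw [hC₁]; exact mul_nonneg (mul_nonneg (abs_nonneg _) (by linarith [Lθ_nonneg (d + 1)])) (Real.exp_nonneg _)
  obtain ⟨s, hs⟩ : ∃ s : ℝ, s = ((ℓ : ℝ) / ((L ^ m * L ^ k : ℕ) : ℝ)) ^ α := ⟨_, rfl⟩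
  have hℓn' : 0 ≤ (ℓ : ℝ) / ((L ^ m * L ^ k : ℕ) : ℝ) := div_nonneg (Nat.cast_nonneg ℓ) hn'0.le
  have hs0 : 0 ≤ s := by rw [hs]; exact Real.rpow_nonneg hℓn' _
  have hn4 : 4 * 1 ≤ L ^ k := by
    have h' : L ^ m * 4 ≤ L ^ m * L ^ k := by nlinarith [h4ℓ, hmℓ]
    simpa using Nat.le_of_mul_le_mul_left h' (Nat.pos_of_ne_zero hR0)
  have hE : ∀ y y' : Tor M, 0 ≤ Real.exp (-(δ₀ * tdistT M y y')) := fun _ _ => Real.exp_nonneg _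
  set bC := BlockNorm.ofBlocks (unitTorusGeo L k M) (blkFine L k M) with hbC
  set bF := BlockNorm.ofBlocks (unitTorusGeo L k M) (fun z : Tor (fine (L ^ m * L ^ k) M) × Fin (d + 1) => blockOf (L ^ m * L ^ k) M z.1) with hbF
  set P := pull (kingPrV L k m M) with hP
  set Y := gOp M (L ^ k) a ∘ₗ symbOp M (L ^ k) (((L ^ k : ℕ) : ℝ) • (sTinv M (L ^ k) μ - 1)) with hY
  set Y' := gOp M (L ^ m * L ^ k) a ∘ₗ symbOp M (L ^ m * L ^ k) (((L ^ m * L ^ k : ℕ) : ℝ) • (sTinv M (L ^ m * L ^ k) μ - 1)) with hY'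
  have ht4 : 4 * t ≤ L ^ m * L ^ k := by omega
  -- (A) the fine oscillation of `G′∇′*` through `P` on the source side
  have hA0 := hasMaj_divSteps_of_ineq (L := L) (k := k) M (L ^ m * L ^ k) a hM2 ht4 HP' hδ₀ hα0 hα1 i μ
  have hts : |Cα α| * (Lθ (d + 1) + 1) * Real.exp δ₀ * ((t : ℝ) / ((L ^ m * L ^ k : ℕ) : ℝ)) ^ α ≤ C₁ * s := by
    rw [hC₁, hs]
    exact mul_le_mul_of_nonneg_left (Real.rpow_le_rpow (div_nonneg (Nat.cast_nonneg t) hn'0.le) (div_le_div_of_nonneg_right (by exact_mod_cast ht.le) hn'0.le) hα0)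
      (by rw [← hC₁]; exact hC₁0)
  have hA : HasMaj bC bF (symbOp M (L ^ m * L ^ k) (sT M (L ^ m * L ^ k) i ^ t - 1) ∘ₗ (Y' ∘ₗ P)) (fun y y' => C₁ * s * Real.exp (-(δ₀ * tdistT M y y'))) := by
    have h := hasMaj_comp_pull_kingPrV M k m (fun y y' => mul_nonneg (mul_nonneg (by rw [← hC₁]; exact hC₁0)
      (Real.rpow_nonneg (div_nonneg (Nat.cast_nonneg t) hn'0.le) _)) (hE y y')) hA0
    rw [← LinearMap.comp_assoc]
    exact (h.congr fun f => rfl).mono fun y y' => mul_le_mul_of_nonneg_right hts (hE y y')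
  -- (B) the coarse member: `t = L^m q + i'`
  obtain ⟨q, hq⟩ : ∃ q : ℕ, q = t / L ^ m := ⟨_, rfl⟩
  obtain ⟨i', hi'⟩ : ∃ i' : ℕ, i' = t % L ^ m := ⟨_, rfl⟩
  have hqi : L ^ m * q + i' = t := by rw [hq, hi']; exact Nat.div_add_mod t (L ^ m)
  have hiR : i' ≤ L ^ m := by rw [hi']; exact (Nat.mod_lt t (Nat.pos_of_ne_zero hR0)).le
  have hq4 : 4 * q ≤ L ^ k := by rw [hq]; exact four_mul_div_le hR0 ht4
  have hRqt : L ^ m * q ≤ t := by rw [hq]; exact Nat.mul_div_le t (L ^ m)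
  have hRq : L ^ m * q ≤ L ^ m * L ^ k := by omega
  have hsplit := shiftSub_X_pull_split M k m i q i' (1 : AddMonoidAlgebra ℝ (Tor (fine (L ^ m * L ^ k) M))) Y
  rw [hqi, map_one, Module.End.one_eq_id, LinearMap.id_comp, LinearMap.id_comp, LinearMap.id_comp] at hsplit
  -- the one-step majorant of `η∇_iY` (part 66, `j = 1`) and the `q`-step one
  have hstep : HasMaj bC bC ((((L ^ k : ℕ) : ℝ)⁻¹ • symbOp M (L ^ k) (sD M (L ^ k) i ((L ^ k : ℕ) : ℝ))) ∘ₗ Y) (fun y y' => C₁ * s * Real.exp (-(δ₀ * tdistT M y y'))) := by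
    rw [inv_smul_symbOp_sD M (L ^ k) i hn0.ne']
    have h := hasMaj_divSteps_of_ineq (L := L) (k := k) M (L ^ k) a hM2 (j := 1) hn4 HP hδ₀ hα0 hα1 i μ
    have h1s : |Cα α| * (Lθ (d + 1) + 1) * Real.exp δ₀ * (((1 : ℕ) : ℝ) / ((L ^ k : ℕ) : ℝ)) ^ α ≤ C₁ * s := by
      rw [hC₁, hs]
      refine mul_le_mul_of_nonneg_left (Real.rpow_le_rpow (div_nonneg (by positivity) hn0.le) ?_ hα0) (by rw [← hC₁]; exact hC₁0)
      -- `1/n ≤ ℓ/n′` since `L^m ≤ ℓ`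
      rw [Nat.cast_one, div_le_div_iff₀ hn0 hn'0, one_mul, Nat.cast_mul]
      have : ((L ^ m : ℕ) : ℝ) ≤ (ℓ : ℝ) := by exact_mod_cast hmℓ
      nlinarith
    exact h.mono fun y y' => mul_le_mul_of_nonneg_right h1s (hE y y')
  have hB1 : HasMaj bC bF (symbOp M (L ^ m * L ^ k) (sT M (L ^ m * L ^ k) i ^ (L ^ m * q)) ∘ₗ ((symbOp M (L ^ m * L ^ k) (sT M (L ^ m * L ^ k) i ^ i') ∘ₗ P - P) ∘ₗ Y))
      (fun y y' => C₁ * s * Real.exp δ₀ * Real.exp (-(δ₀ * tdistT M y y'))) :=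
    hasMaj_sT_pow_comp M k (L ^ m * L ^ k) (mul_nonneg hC₁0 hs0) hδ₀ i hRq (hasMaj_shiftPull_sub M k m (fun y y' => mul_nonneg (mul_nonneg hC₁0 hs0) (hE y y')) i hiR hstep)
  have hB2 : HasMaj bC bF (P ∘ₗ (symbOp M (L ^ k) (sT M (L ^ k) i ^ q - 1) ∘ₗ Y)) (fun y y' => C₁ * s * Real.exp (-(δ₀ * tdistT M y y'))) := by
    have hc0 := hasMaj_divSteps_of_ineq (L := L) (k := k) M (L ^ k) a hM2 hq4 HP hδ₀ hα0 hα1 i μ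
    have hqn0 : 0 ≤ (q : ℝ) / ((L ^ k : ℕ) : ℝ) := div_nonneg (Nat.cast_nonneg q) hn0.le
    have hqs : |Cα α| * (Lθ (d + 1) + 1) * Real.exp δ₀ * ((q : ℝ) / ((L ^ k : ℕ) : ℝ)) ^ α ≤ C₁ * s := by
      rw [hC₁, hs]
      refine mul_le_mul_of_nonneg_left (Real.rpow_le_rpow hqn0 ?_ hα0) (by rw [← hC₁]; exact hC₁0)
      rw [div_le_div_iff₀ hn0 hn'0, Nat.cast_mul]
      have h1 : ((L ^ m : ℕ) : ℝ) * (q : ℝ) ≤ (t : ℝ) := by exact_mod_cast hRqt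
      have h2 : (t : ℝ) ≤ (ℓ : ℝ) := by exact_mod_cast ht.le
      have h3 : (0 : ℝ) ≤ ((L ^ k : ℕ) : ℝ) := hn0.le
      nlinarith
    have hc : HasMaj bC bC ((symbOp M (L ^ k) (sT M (L ^ k) i ^ q - 1) ∘ₗ Y)) (fun y y' => C₁ * s * Real.exp (-(δ₀ * tdistT M y y'))) := by
      rw [hY, ← LinearMap.comp_assoc]
      exact hc0.mono fun y y' => mul_le_mul_of_nonneg_right hqs (hE y y')
    have hK0 : ∀ y y' : Tor M, 0 ≤ C₁ * s * Real.exp (-(δ₀ * tdistT M y y')) := fun y y' => mul_nonneg (mul_nonneg hC₁0 hs0) (hE y y')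
    exact hasMaj_pull_comp₂ (g := unitTorusGeo L k M) (b₁ := bC) (blkFine L k M)
      (fun z : Tor (fine (L ^ m * L ^ k) M) × Fin (d + 1) => blockOf (L ^ m * L ^ k) M z.1) (kingPrV L k m M) hK0
      (fun x y' => by rw [show blkFine L k M (kingPrV L k m M x) = blockOf (L ^ m * L ^ k) M x.1 from congrFun (blkFine_comp_kingPrV M L k m) x]) hc
  -- assembly
  rw [idef, LinearMap.comp_sub, hsplit]
  refine ((hA.sub (hB1.add hB2)).congr fun f => rfl).mono fun y y' => le_of_eq ?_
  rw [hC₁, hs]; ring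

/-- **THE A-PRIORI BOUND** for `T2` (no rate): `2C·e^{−δ₀d}` from (1.110) «G∇*J» on both members. [cite: Balaban1984PropagatorsI, Prop. 1.2 (1.110) p.35] -/
theorem hasMaj_entry2_apriori (μ : Fin (d + 1)) {K K' : ℕ} {C δ₀ : ℝ} {Cα Cε : ℝ → ℝ} {Cαε : ℝ → ℝ → ℝ} (hC : 0 ≤ C)
    (H1 : B5.Ineq110_114 (latticeSettingP12R (L ^ k) M a K) C Cα Cε Cαε δ₀) (H2 : B5.Ineq110_114 (latticeSettingP12R (L ^ m * L ^ k) M a K') C Cα Cε Cαε δ₀) :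
    HasMaj (BlockNorm.ofBlocks (unitTorusGeo L k M) (blkFine L k M))
      (BlockNorm.ofBlocks (unitTorusGeo L k M) (fun z : Tor (fine (L ^ m * L ^ k) M) × Fin (d + 1) => blockOf (L ^ m * L ^ k) M z.1))
      (idef (pull (kingPrV L k m M)) (pull (kingPrV L k m M))
        (gOp M (L ^ m * L ^ k) a ∘ₗ symbOp M (L ^ m * L ^ k) (((L ^ m * L ^ k : ℕ) : ℝ) • (sTinv M (L ^ m * L ^ k) μ - 1)))
        (gOp M (L ^ k) a ∘ₗ symbOp M (L ^ k) (((L ^ k : ℕ) : ℝ) • (sTinv M (L ^ k) μ - 1))))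
      (fun y y' => 2 * C * Real.exp (-(δ₀ * tdistT M y y'))) := by
  classical
  haveI : NeZero (L ^ m * L ^ k) := ⟨Nat.mul_ne_zero (pow_ne_zero m (NeZero.ne L)) (pow_ne_zero k (NeZero.ne L))⟩
  have hL0 : 0 < L := Nat.pos_of_ne_zero (NeZero.ne L)
  have hn1 : 1 ≤ L ^ k := Nat.one_le_pow _ _ hL0
  have hn'1 : 1 ≤ L ^ m * L ^ k := Nat.one_le_iff_ne_zero.mpr (NeZero.ne _)
  have hK0 : ∀ y y' : Tor M, 0 ≤ C * Real.exp (-(δ₀ * tdistT M y y')) := fun y y' => mul_nonneg hC (Real.exp_nonneg _)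
  have hf := hasMaj_comp_pull_kingPrV M k m hK0 (hasMaj_gDivAdj_of_ineq (L := L) (k := k) M (L ^ m * L ^ k) a hn'1 H2 hC μ)
  have hc := hasMaj_pull_comp₂ (g := unitTorusGeo L k M) (b₁ := BlockNorm.ofBlocks (unitTorusGeo L k M) (blkFine L k M)) (blkFine L k M)
    (fun z : Tor (fine (L ^ m * L ^ k) M) × Fin (d + 1) => blockOf (L ^ m * L ^ k) M z.1) (kingPrV L k m M) hK0
    (fun x y' => by rw [show blkFine L k M (kingPrV L k m M x) = blockOf (L ^ m * L ^ k) M x.1 from congrFun (blkFine_comp_kingPrV M L k m) x])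
    (hasMaj_gDivAdj_of_ineq (L := L) (k := k) M (L ^ k) a hn1 H1 hC μ)
  rw [idef]
  exact ((hf.congr fun μ => rfl).sub hc).mono fun y y' => le_of_eq (by ring)

end Osc

/-! ## §114 ★★★ ENTRY 2 in sup-block currency on the η-pair of record -/

section Family

variable {L : ℕ} [NeZero L]

omit [NeZero L] in
/-- `√(x^a)·(x^k)^{−1∕4} ≤ (x^k)^{−1∕8}` for `x ≥ 1`, `4a ≤ k`. [folklore] -/
theorem sqrt_pow_mul_rpow_le {x : ℝ} (hx : 1 ≤ x) {a k : ℕ} (h : 4 * a ≤ k) :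
    Real.sqrt (x ^ a) * (x ^ k) ^ (-(1 / 4 : ℝ)) ≤ (x ^ k) ^ (-(1 / 8 : ℝ)) := by
  have hx0 : 0 < x := by linarith
  have hxk : 0 < x ^ k := pow_pos hx0 k
  have h4 : (a : ℝ) * (1 / 2) ≤ (k : ℝ) * (1 / 8) := by
    have : ((4 * a : ℕ) : ℝ) ≤ (k : ℝ) := by exact_mod_cast h
    push_cast at this; linarith
  have h1 : Real.sqrt (x ^ a) ≤ (x ^ k) ^ (1 / 8 : ℝ) := by
    rw [Real.sqrt_eq_rpow, ← Real.rpow_natCast x a, ← Real.rpow_natCast x k, ← Real.rpow_mul hx0.le, ← Real.rpow_mul hx0.le]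
    exact Real.rpow_le_rpow_of_exponent_le hx h4
  calc Real.sqrt (x ^ a) * (x ^ k) ^ (-(1 / 4 : ℝ)) ≤ (x ^ k) ^ (1 / 8 : ℝ) * (x ^ k) ^ (-(1 / 4 : ℝ)) :=
        mul_le_mul_of_nonneg_right h1 (Real.rpow_nonneg hxk.le _)
    _ = (x ^ k) ^ (-(1 / 8 : ℝ)) := by rw [← Real.rpow_add hxk]; norm_num

omit [NeZero L] in
/-- `((x^j)⁻¹)^{1∕2} ≤ x^{1∕2}·(x^k)^{−1∕(2c)}` for `x ≥ 1`, `0 < c`, `k < c(j+1)`. [folklore] -/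
theorem pow_rpow_neg_half_le {x : ℝ} (hx : 1 ≤ x) {j k c : ℕ} (hc : 0 < c) (h : k < c * (j + 1)) :
    ((x ^ j)⁻¹) ^ (1 / 2 : ℝ) ≤ x ^ (1 / 2 : ℝ) * (x ^ k) ^ (-(1 / (2 * (c : ℝ)))) := by
  have hx0 : 0 < x := by linarith
  have hc0 : (0 : ℝ) < c := by exact_mod_cast hc
  have e1 : ((x ^ j)⁻¹) ^ (1 / 2 : ℝ) = x ^ (-(j : ℝ) * (1 / 2)) := by
    rw [← Real.rpow_natCast x j, ← Real.rpow_neg hx0.le, ← Real.rpow_mul hx0.le]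
  have e2 : x ^ (1 / 2 : ℝ) * (x ^ k) ^ (-(1 / (2 * (c : ℝ)))) = x ^ (1 / 2 + (k : ℝ) * (-(1 / (2 * (c : ℝ))))) := by
    rw [← Real.rpow_natCast x k, ← Real.rpow_mul hx0.le, Real.rpow_add hx0]
  rw [e1, e2]
  refine Real.rpow_le_rpow_of_exponent_le hx ?_
  have hk : (k : ℝ) ≤ (c : ℝ) * ((j : ℝ) + 1) := by
    have : ((k : ℕ) : ℝ) ≤ ((c * (j + 1) : ℕ) : ℝ) := by exact_mod_cast h.le
    push_cast at this; linarith
  rw [show (k : ℝ) * (-(1 / (2 * (c : ℝ)))) = -((k : ℝ) / c) / 2 by ring]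
  have : (k : ℝ) / c ≤ (j : ℝ) + 1 := by rw [div_le_iff₀ hc0]; linarith
  linarith

/-- ★★★ **ENTRY 2 OF [B9] (3.42) FOR BAŁABAN's FULL LANDAU-GAUGE PAIR `(G′, G) = (Δ′_a⁻¹, Δ_a⁻¹)` AT `U ≡ 1`, SUP-BLOCK CURRENCY, HYPOTHESIS-FREE** (see the module docstring): for
odd `L ≥ 3` and `a > 0` there are `δ, C > 0` such that for EVERY torus exponent `m_T`, EVERY coarse scale `k ≥ 1`, EVERY refinement exponent `m` and every direction `μ`,
`𝔇(G∇_μ*) = G′∇′_μ*P − PG∇_μ*` has the block majorant `C·(L^k)^{−1∕(8(d+1))}·e^{−δ|y−y′|_T}` from coarse 1-forms localised in King's unit blocks (sup) to fine 1-forms observed on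
unit blocks (sup) — the honest `T2` of part 60's `ne2ZeroOperator_fullG_of_entry2`.  Inputs: parts 69, 70, 66, 58, 44, 43, 42 (every analytic input a tree theorem).
[cite: Balaban1985BackgroundPropagators, Thm 3.1 (3.42) p.397 (the entry G∇*); King1986, Prop. 3.9 (3.73) p.665 (η-rate shape, A = 0 model)] -/
theorem hasMaj_twoGridDefect_div (hLodd : Odd L) (hL2 : 2 ≤ L) {a : ℝ} (ha : 0 < a) :
    ∃ δ C : ℝ, 0 < δ ∧ 0 < C ∧ ∀ (mT k m : ℕ) (hk : 1 ≤ k) (hL : Odd L ∧ 1 < L) (μ : Fin (d + 1)),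
      HasMaj (BlockNorm.ofBlocks (unitTorusGeo L k (MP (paramsOf d L mT k hL))) (blkFine L k (MP (paramsOf d L mT k hL))))
        (BlockNorm.ofBlocks (unitTorusGeo L k (MP (paramsOf d L mT k hL)))
          (fun z : Tor (fine (L ^ m * L ^ k) (MP (paramsOf d L mT k hL))) × Fin (d + 1) => blockOf (L ^ m * L ^ k) (MP (paramsOf d L mT k hL)) z.1))
        (idef (pull (kingPrV L k m (MP (paramsOf d L mT k hL)))) (pull (kingPrV L k m (MP (paramsOf d L mT k hL))))
          (gOp (MP (paramsOf d L mT k hL)) (L ^ m * L ^ k) a ∘ₗ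
            symbOp (MP (paramsOf d L mT k hL)) (L ^ m * L ^ k) (((L ^ m * L ^ k : ℕ) : ℝ) • (sTinv (MP (paramsOf d L mT k hL)) (L ^ m * L ^ k) μ - 1)))
          (gOp (MP (paramsOf d L mT k hL)) (L ^ k) a ∘ₗ symbOp (MP (paramsOf d L mT k hL)) (L ^ k) (((L ^ k : ℕ) : ℝ) • (sTinv (MP (paramsOf d L mT k hL)) (L ^ k) μ - 1))))
        (fun y y' => C * ((L ^ k : ℕ) : ℝ) ^ (-(1 / (8 * ((d : ℝ) + 1)))) * Real.exp (-(δ * tdistT (MP (paramsOf d L mT k hL)) y y'))) := by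
  classical
  have hL : Odd L ∧ 1 < L := ⟨hLodd, by omega⟩
  have hL0 : 0 < L := by omega
  have hLr1 : (1 : ℝ) ≤ (L : ℝ) := by exact_mod_cast (show 1 ≤ L by omega)
  have hLr0 : (0 : ℝ) < (L : ℝ) := by linarith
  obtain ⟨δ₂, C₂, hδ₂, hC₂, H2⟩ := hasMajL2_twoGridDefect_div (d := d) hLodd hL2 ha (γ := 1 / 2) (by norm_num) (by norm_num)
  obtain ⟨δ₅, C₀, Cα, Cε, Cαε, hδ₅, hC₀, H5⟩ := ineq110_114_pair (d := d) hL ha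
  obtain ⟨δ, hδ⟩ : ∃ δ : ℝ, δ = min δ₂ δ₅ := ⟨_, rfl⟩
  have hδpos : 0 < δ := by rw [hδ]; exact lt_min hδ₂ hδ₅
  have hδ2 : δ ≤ δ₂ := by rw [hδ]; exact min_le_left _ _
  have hδ5 : δ ≤ δ₅ := by rw [hδ]; exact min_le_right _ _
  obtain ⟨C₁, hC₁⟩ : ∃ C₁ : ℝ, C₁ = |Cα (1 / 2)| * (Lθ (d + 1) + 1) * Real.exp δ₅ := ⟨_, rfl⟩
  have hC₁0 : 0 ≤ C₁ := by rw [hC₁]; exact mul_nonneg (mul_nonneg (abs_nonneg _) (by linarith [Lθ_nonneg (d + 1)])) (Real.exp_nonneg _)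
  obtain ⟨Cbig, hCbig⟩ : ∃ Cbig : ℝ, Cbig = C₂ + 2 * ((d : ℝ) + 1) * Real.exp δ ^ (d + 1) * (C₁ * (2 + Real.exp δ₅) * (L : ℝ) ^ (1 / 2 : ℝ)) + 2 * C₀ * L := ⟨_, rfl⟩
  have hCbig0 : 0 ≤ Cbig := by rw [hCbig]; positivity
  refine ⟨δ, Cbig + 1, hδpos, by positivity, fun mT k m hk hL' μ => ?_⟩
  haveI : NeZero (L ^ k) := ⟨pow_ne_zero k (by omega)⟩
  have hM2 : ∀ μ, 2 ≤ MP (paramsOf d L mT k hL') μ := fun μ => Nat.le_mul_of_pos_right 2 (pow_pos hL0 mT)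
  have hn1 : 1 ≤ L ^ k := Nat.one_le_pow _ _ hL0
  have hn0 : (0 : ℝ) < ((L ^ k : ℕ) : ℝ) := by exact_mod_cast hn1
  have hnr1 : (1 : ℝ) ≤ ((L ^ k : ℕ) : ℝ) := by exact_mod_cast hn1
  have hncast : ((L ^ k : ℕ) : ℝ) = (L : ℝ) ^ k := by push_cast; ring
  obtain ⟨r, hr⟩ : ∃ r : ℝ, r = ((L ^ k : ℕ) : ℝ) ^ (-(1 / (8 * ((d : ℝ) + 1)))) := ⟨_, rfl⟩
  have hr0 : 0 ≤ r := by rw [hr]; exact Real.rpow_nonneg hn0.le _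
  have hE : ∀ y y' : Tor (MP (paramsOf d L mT k hL')), 0 ≤ Real.exp (-(δ * tdistT (MP (paramsOf d L mT k hL')) y y')) := fun _ _ => Real.exp_nonneg _
  have HP := (H5 mT k m hk).1
  have HP' := (H5 mT k m hk).2
  by_cases hkD : 8 * (d + 1) ≤ k
  · -- sub-boxes of side `ℓ = L^m·L^{k−j₀}`, `j₀ = ⌊k∕(4(d+1))⌋ ≥ 2`
    obtain ⟨j₀, hj₀⟩ : ∃ j₀ : ℕ, j₀ = k / (4 * (d + 1)) := ⟨_, rfl⟩
    have hj₀2 : 2 ≤ j₀ := by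
      rw [hj₀]; exact (Nat.le_div_iff_mul_le (by positivity)).mpr (by linarith)
    have hj₀k : j₀ ≤ k := by rw [hj₀]; exact Nat.div_le_self k (4 * (d + 1))
    have h4j : 4 * (j₀ * (d + 1)) ≤ k := by
      have := Nat.div_mul_le_self k (4 * (d + 1))
      rw [hj₀]; nlinarith [this]
    have hklt : k < 4 * (d + 1) * (j₀ + 1) := by rw [hj₀]; exact Nat.lt_mul_div_succ k (by positivity)
    obtain ⟨ℓ, hℓ⟩ : ∃ ℓ : ℕ, ℓ = L ^ m * L ^ (k - j₀) := ⟨_, rfl⟩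
    have hkj : L ^ (k - j₀) * L ^ j₀ = L ^ k := by rw [← pow_add, Nat.sub_add_cancel hj₀k]
    have hLj4 : 4 ≤ L ^ j₀ := le_trans (by nlinarith : 4 ≤ L ^ 2) (Nat.pow_le_pow_right hL0 hj₀2)
    have hℓ1 : 1 ≤ ℓ := by rw [hℓ]; exact Nat.one_le_iff_ne_zero.mpr (Nat.mul_ne_zero (pow_ne_zero m (by omega)) (pow_ne_zero _ (by omega)))
    have hℓfac : L ^ m * L ^ k = ℓ * L ^ j₀ := by rw [hℓ, mul_assoc, hkj]
    have hℓn : ℓ ∣ L ^ m * L ^ k := ⟨L ^ j₀, hℓfac⟩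
    have h4ℓ : 4 * ℓ ≤ L ^ m * L ^ k := by
      calc 4 * ℓ = L ^ m * (L ^ (k - j₀) * 4) := by rw [hℓ]; ring
        _ ≤ L ^ m * (L ^ (k - j₀) * L ^ j₀) := Nat.mul_le_mul_left _ (Nat.mul_le_mul_left _ hLj4)
        _ = L ^ m * L ^ k := by rw [hkj]
    have hmℓ : L ^ m ≤ ℓ := by rw [hℓ]; exact Nat.le_mul_of_pos_right _ (pow_pos hL0 _)
    have hquot : (L ^ m * L ^ k) / ℓ = L ^ j₀ := by
      rw [hℓfac, Nat.mul_div_cancel_left _ (by omega)]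
    -- the L²-block majorant of part 69 and the oscillations of §113, at the common rate `δ`
    have h2 := (H2 mT k m hk hL' μ).mono fun y y' =>
      mul_le_mul_of_nonneg_left (Real.exp_le_exp.mpr (neg_le_neg (mul_le_mul_of_nonneg_right hδ2 (tdistT_nonneg _ y y'))))
        (mul_nonneg hC₂.le (Real.rpow_nonneg hn0.le _))
    have hosc : ∀ (i : Fin (d + 1)) (t : ℕ), t < ℓ → HasMaj (BlockNorm.ofBlocks (unitTorusGeo L k (MP (paramsOf d L mT k hL'))) (blkFine L k (MP (paramsOf d L mT k hL'))))
        (BlockNorm.ofBlocks (unitTorusGeo L k (MP (paramsOf d L mT k hL'))) (fun z : Tor (fine (L ^ m * L ^ k) (MP (paramsOf d L mT k hL'))) × Fin (d + 1) => blockOf (L ^ m * L ^ k) (MP (paramsOf d L mT k hL')) z.1))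
        (symbOp (MP (paramsOf d L mT k hL')) (L ^ m * L ^ k) (sT (MP (paramsOf d L mT k hL')) (L ^ m * L ^ k) i ^ t - 1) ∘ₗ
          idef (pull (kingPrV L k m (MP (paramsOf d L mT k hL')))) (pull (kingPrV L k m (MP (paramsOf d L mT k hL'))))
            (gOp (MP (paramsOf d L mT k hL')) (L ^ m * L ^ k) a ∘ₗ symbOp (MP (paramsOf d L mT k hL')) (L ^ m * L ^ k) (((L ^ m * L ^ k : ℕ) : ℝ) • (sTinv (MP (paramsOf d L mT k hL')) (L ^ m * L ^ k) μ - 1)))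
            (gOp (MP (paramsOf d L mT k hL')) (L ^ k) a ∘ₗ symbOp (MP (paramsOf d L mT k hL')) (L ^ k) (((L ^ k : ℕ) : ℝ) • (sTinv (MP (paramsOf d L mT k hL')) (L ^ k) μ - 1))))
        (fun y y' => C₁ * (2 + Real.exp δ₅) * ((ℓ : ℝ) / ((L ^ m * L ^ k : ℕ) : ℝ)) ^ (1 / 2 : ℝ) * Real.exp (-(δ * tdistT (MP (paramsOf d L mT k hL')) y y'))) := by
      intro i t ht
      have h := hasMaj_osc_entry2 (L := L) (MP (paramsOf d L mT k hL')) k m a hM2 hδ₅.le HP HP' (α := 1 / 2) (by norm_num) (by norm_num) h4ℓ hmℓ μ i ht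
      refine h.mono fun y y' => ?_
      rw [← hC₁]
      exact mul_le_mul_of_nonneg_left (Real.exp_le_exp.mpr (neg_le_neg (mul_le_mul_of_nonneg_right hδ5 (tdistT_nonneg _ y y'))))
        (mul_nonneg (mul_nonneg hC₁0 (by positivity)) (Real.rpow_nonneg (div_nonneg (Nat.cast_nonneg _) (Nat.cast_nonneg _)) _))
    have hmain := hasMaj_sup_of_l2Blocks_osc (MP (paramsOf d L mT k hL')) k (L ^ m * L ^ k) hℓ1 hℓn (B₂ := C₂ * ((L ^ k : ℕ) : ℝ) ^ (-((1 : ℝ) / 2 / 2)))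
      (Bosc := C₁ * (2 + Real.exp δ₅) * ((ℓ : ℝ) / ((L ^ m * L ^ k : ℕ) : ℝ)) ^ (1 / 2 : ℝ))
      (mul_nonneg (mul_nonneg hC₁0 (by positivity)) (Real.rpow_nonneg (div_nonneg (Nat.cast_nonneg _) (Nat.cast_nonneg _)) _)) hδpos.le h2 hosc
    refine hmain.mono fun y y' => mul_le_mul_of_nonneg_right ?_ (hE y y')
    -- rate bookkeeping
    rw [hquot, ← hr]
    have hsq : Real.sqrt ((((L ^ j₀ : ℕ) : ℝ)) ^ (d + 1)) = Real.sqrt ((L : ℝ) ^ (j₀ * (d + 1))) := by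
      push_cast; rw [← pow_mul]
    have h1 : Real.sqrt ((((L ^ j₀ : ℕ) : ℝ)) ^ (d + 1)) * (C₂ * ((L ^ k : ℕ) : ℝ) ^ (-((1 : ℝ) / 2 / 2))) ≤ C₂ * r := by
      rw [hsq, hncast, show (-((1 : ℝ) / 2 / 2)) = -(1 / 4 : ℝ) by norm_num, mul_left_comm]
      refine mul_le_mul_of_nonneg_left ((sqrt_pow_mul_rpow_le hLr1 h4j).trans ?_) hC₂.le
      rw [hr, hncast]
      exact Real.rpow_le_rpow_of_exponent_le (one_le_pow₀ hLr1) (by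
        rw [neg_le_neg_iff, one_div_le_one_div (by positivity) (by norm_num)]; have : (0 : ℝ) ≤ d := Nat.cast_nonneg d; nlinarith)
    have h2' : ((ℓ : ℝ) / ((L ^ m * L ^ k : ℕ) : ℝ)) ^ (1 / 2 : ℝ) ≤ (L : ℝ) ^ (1 / 2 : ℝ) * r := by
      have e : (ℓ : ℝ) / ((L ^ m * L ^ k : ℕ) : ℝ) = ((L : ℝ) ^ j₀)⁻¹ := by
        have hℓ0 : (ℓ : ℝ) ≠ 0 := by exact_mod_cast (by omega : ℓ ≠ 0)
        rw [hℓfac]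
        push_cast
        rw [← div_div, div_self hℓ0, one_div]
      rw [e, hr, hncast, show (1 / (8 * ((d : ℝ) + 1))) = 1 / (2 * (((4 * (d + 1) : ℕ) : ℝ))) by push_cast; ring]
      exact pow_rpow_neg_half_le hLr1 (by positivity) hklt
    calc Real.sqrt ((((L ^ j₀ : ℕ) : ℝ)) ^ (d + 1)) * (C₂ * ((L ^ k : ℕ) : ℝ) ^ (-((1 : ℝ) / 2 / 2)))
          + 2 * ((d : ℝ) + 1) * Real.exp δ ^ (d + 1) * (C₁ * (2 + Real.exp δ₅) * ((ℓ : ℝ) / ((L ^ m * L ^ k : ℕ) : ℝ)) ^ (1 / 2 : ℝ))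
        ≤ C₂ * r + 2 * ((d : ℝ) + 1) * Real.exp δ ^ (d + 1) * (C₁ * (2 + Real.exp δ₅) * ((L : ℝ) ^ (1 / 2 : ℝ) * r)) := by
          gcongr
      _ = (Cbig - 2 * C₀ * L) * r := by rw [hCbig]; ring
      _ ≤ (Cbig + 1) * r := mul_le_mul_of_nonneg_right (by nlinarith [hC₀.le, hLr0.le]) hr0
  · -- `k < 8D`: the a-priori bound, `1 ≤ L·r`
    have hap := hasMaj_entry2_apriori (L := L) (MP (paramsOf d L mT k hL')) k m a μ hC₀.le HP HP'
    have hLr : 1 ≤ (L : ℝ) * r := by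
      rw [hr, hncast, ← Real.rpow_natCast (L : ℝ) k, ← Real.rpow_mul hLr0.le]
      have e : (L : ℝ) * (L : ℝ) ^ ((k : ℝ) * -(1 / (8 * ((d : ℝ) + 1)))) = (L : ℝ) ^ (1 + (k : ℝ) * -(1 / (8 * ((d : ℝ) + 1)))) := by
        rw [Real.rpow_add hLr0, Real.rpow_one]
      rw [e]
      refine Real.one_le_rpow hLr1 ?_
      have hk8 : (k : ℝ) < 8 * ((d : ℝ) + 1) := by
        have : ((k : ℕ) : ℝ) < ((8 * (d + 1) : ℕ) : ℝ) := by exact_mod_cast (by omega : k < 8 * (d + 1))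
        push_cast at this; linarith
      have hpos : (0 : ℝ) < 8 * ((d : ℝ) + 1) := by positivity
      rw [show (k : ℝ) * -(1 / (8 * ((d : ℝ) + 1))) = -((k : ℝ) / (8 * ((d : ℝ) + 1))) by ring]
      have : (k : ℝ) / (8 * ((d : ℝ) + 1)) < 1 := by rw [div_lt_one hpos]; exact hk8
      linarith
    refine hap.mono fun y y' => ?_
    rw [← hr]
    calc 2 * C₀ * Real.exp (-(δ₅ * tdistT (MP (paramsOf d L mT k hL')) y y')) ≤ 2 * C₀ * Real.exp (-(δ * tdistT (MP (paramsOf d L mT k hL')) y y')) :=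
          mul_le_mul_of_nonneg_left (Real.exp_le_exp.mpr (neg_le_neg (mul_le_mul_of_nonneg_right hδ5 (tdistT_nonneg _ y y')))) (by positivity)
      _ ≤ 2 * C₀ * ((L : ℝ) * r) * Real.exp (-(δ * tdistT (MP (paramsOf d L mT k hL')) y y')) := by
          have h0 : 0 ≤ 2 * C₀ * Real.exp (-(δ * tdistT (MP (paramsOf d L mT k hL')) y y')) := by positivity
          nlinarith
      _ = (2 * C₀ * L) * r * Real.exp (-(δ * tdistT (MP (paramsOf d L mT k hL')) y y')) := by ring
      _ ≤ (Cbig + 1) * r * Real.exp (-(δ * tdistT (MP (paramsOf d L mT k hL')) y y')) := by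
          refine mul_le_mul_of_nonneg_right (mul_le_mul_of_nonneg_right ?_ hr0) (hE y y')
          rw [hCbig]
          have : 0 ≤ C₂ + 2 * ((d : ℝ) + 1) * Real.exp δ ^ (d + 1) * (C₁ * (2 + Real.exp δ₅) * (L : ℝ) ^ (1 / 2 : ℝ)) := by positivity
          linarith

end Family

end Summit.QuantumFields.YangMills.BalabanUVNodes.N15.TwoGrid
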